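import Summits.HodgeConjecture.HodgeConjecture.Theorems.F0P3StubS5OfLetters
import Summits.HodgeConjecture.HodgeConjecture.Theorems.H413CohFormsL2
import HarnessLib

/-!
# Crux `H413`, line `F0_U3CohMultOne` — STUB S5 CLOSED MODULO EXACTLY THE THREE PRINTED-CITATION LETTERS E2′, (D)hol, (D)antihol

Floor-0 programme P3 «U3-mult», seat F0P3-p02 (g0); crux item stmt-HodgeConjecture-24833 (`HCCMUnconditional.H413`).
HC_CM is proved only modulo the printed citations until rung 0 closes.

`stubS5_holds` = ★ `F0P3StubS5Fold.stubS5_of_letters` with its last hypothesis — continuity of the cohomological cotangent forms of the factor of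
record on `U(V)(𝔸_{F⁺})` — DISCHARGED by ★ `CohFormsL2.continuous_apply_of_mem_cohForms` (F0P2-p01, `Theorems/H413CohFormsL2.lean`, over ★
`P2StubU2lL2Realisation.continuous_of_mem_cohForms`: holomorphic germs + cotangent weight ⇒ continuity along `U(2,1)`, local constancy along
`U(V)(𝔸_{F⁺,f})`, product topology ★ `UnitaryGroupAdelicProduct`).  What remains are NAMED FACTS only: the engine letter E2′ ★
`Literature.NumberTheory.Rogawski1990.hodgeTypeRigid` ([Rogawski1990, Thm. 13.3.6 (c), §15.3 ¶1, §12.3, Thm. 14.6.4, Thm. 13.3.5]) and the analytic letters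
(D) ★ `CotangentForms.holCotFormSpectralProjection` / `antiholCotFormSpectralProjection` ([BorelJacquet1979, §4.6]; [Borel1997, Thm. 2.13, §8.4]) —
so this is a CONDITIONAL RESULT in the sense of the honest label, and the conclusion is the body of the registered stub
`StubS5HodgeTypeExclusionAt` (`Cruxes/H413/Lines/F0_U3CohMultOne.lean` v1.1 ll. 239–251) TOKEN-IDENTICALLY: the line's edition reads
`theorem stub_S5_hodgeTypeExclusionAt : StubS5HodgeTypeExclusionAt := F0P3StubS5Fold.stubS5_holds hE2' hDh hDa` inside a head taking the letters.

References: [Rogawski1990] Thm. 13.3.6 (c), §15.3 ¶1, §12.3 p. 174, Thm. 14.6.4, Thm. 13.3.5; [BorelJacquet1979] §4.2, §4.6; [Borel1997] Thm. 2.13, §8.4;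
[Liu2021] proof of Prop. 4.13 l. 2140–2146, Lem. D.2 (2); [Marshall2014] §3.3.
-/

-- the mandated namespace repeats `HodgeConjecture.HodgeConjecture`, as in every `Theorems/*.lean` of this sub-problem
set_option linter.dupNamespace false

noncomputable section

namespace Summit.HodgeConjecture.HodgeConjecture.Cruxes.H413.F0P3StubS5Fold

open scoped TensorProduct Matrix InnerProductSpace ENNReal ComplexOrder
open MeasureTheory
open NumberField NumberField.InfinitePlace IsDedekindDomain
open HodgeCM.Model HodgeCM.Model.LiuIndex HodgeCM.Model.TowerCarrier
open Summit.HodgeConjecture.CorCM.Model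
open Literature.AlgebraicGeometry.Motives (CMType AbelianVariety)
open Literature.AlgebraicGeometry.HodgeTheory Literature.NumberTheory.Automorphic.PicardCM
open Literature.AlgebraicGeometry.ShimuraVarieties Literature.AlgebraicGeometry.ShimuraVarieties.UnitaryCanonicalModel
open Literature.NumberTheory.ComplexMultiplication
open Literature.NumberTheory.Automorphic
open Literature.NumberTheory.Automorphic.Liu2021 Literature.NumberTheory.Automorphic.Liu2021.AppendixC
open Literature.NumberTheory.Automorphic.Liu2021.Def411WeilCarriers (lineOf locF Rep)
open Summit.HodgeConjecture.CorCM.Transposition.OmegaTransport (realUnit)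
open HodgeCM.Model.ArchSideTerm (e₁)
open Literature.NumberTheory.GelbartRogawski1991 Literature.NumberTheory.GelbartRogawski1991.UnitaryDualPair
open Literature.RepresentationTheory Literature.RepresentationTheory.Liu2021
open Summit.HodgeConjecture.CorCM
open Summit.HodgeConjecture.CorCM.Transposition
open Literature.NumberTheory.GelbartRogawski1991.OscillatorTripleDictionary (OccursInH1 IsIsoToOmega)
open Summit.HodgeConjecture.HodgeConjecture.Theses (HCCMUnconditional.HDel)
open MulAction
open Literature.Geometry.ComplexHyperbolic.BallModel (U21 x₀)
open Literature.NumberTheory.GelbartRogawski1991.OscillatorTripleDictionary (rhoTriple)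
open Summit.HodgeConjecture.CorCM.Lines.A3Liu413 (datum413)
open Summit.HodgeConjecture.HodgeConjecture.Cruxes.H413.CohFormsCarriers
open Literature.NumberTheory.Automorphic.UnitaryGroup
open Literature.NumberTheory.Automorphic.UnitaryGroup.CotangentForms (toQuotFun cmArchSection cmCompactFactor)
open Summit.HodgeConjecture.HodgeConjecture.Cruxes.H413.F0P3SpectralJunction
open Summit.HodgeConjecture.HodgeConjecture.Cruxes.H413.F0P3HilbertProjection
open Summit.HodgeConjecture.HodgeConjecture.Cruxes.H413.SpectrumJunction (continuous_toQuotFun compactSpace_automorphicQuotient_adelicDatum)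



set_option synthInstance.maxHeartbeats 400000 in
set_option maxHeartbeats 8000000 in
/-- **STUB S5 — HODGE-TYPE EXCLUSION AT THE PIN — modulo exactly the letters E2′, (D)hol, (D)antihol (named facts, by name).**  For every face,
`3 ≤ n` and every admissible weight-one triple `t`: either every `U(V)(𝔸_{F⁺,f})`-equivariant linear map `ω_V(t) → (U(V)(𝔸_{F⁺}) → ℂ²)` valued in
the holomorphic cotangent forms of the factor of record vanishes, or every one valued in their conjugates does.
HC_CM is proved only modulo the printed citations until rung 0 closes. [cite: Rogawski1990, Thm. 13.3.6 (c); §15.3 ¶1; §12.3 p. 174; Thm. 14.6.4;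
Thm. 13.3.5] [cite: BorelJacquet1979, §4.6] [cite: Borel1997, Thm. 2.13 and §8.4] [cite: Liu2021, proof of Prop. 4.13, l. 2140–2146; Lem. D.2 (2)] -/
theorem stubS5_holds (hE2' : Literature.NumberTheory.Rogawski1990.hodgeTypeRigid)
    (hDh : Literature.NumberTheory.Automorphic.UnitaryGroup.CotangentForms.holCotFormSpectralProjection)
    (hDa : Literature.NumberTheory.Automorphic.UnitaryGroup.CotangentForms.antiholCotFormSpectralProjection) :
    ∀ (hDel : Literature.AlgebraicGeometry.ShimuraVarieties.UnitaryCanonicalModel.canonicalModel_exists_printed)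
      (F : HodgeCM.CMField) [IsGalois ℚ F] (h6 : 6 ≤ Module.finrank ℚ F) {ι₁ : F →+* ℂ} (V : HodgeCM.HermSpace3 F ι₁) (a₀ : RealScalar F)
      (Φ : CMType F) (hΦ : ι₁ ∈ Φ.1) (i : (I V (repAt a₀) (muLiu ι₁ GramClass.rep))),
      3 ≤ (datum413 hDel F V a₀ Φ i).n → ∀ t : (datum413 hDel F V a₀ Φ i).AdmTriple,
        (∀ ψ : (datum413 hDel F V a₀ Φ i).omegaAt t →ₗ[ℂ] ((adelicDatum F V).Adelic → (Fin 2 → ℂ)),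
            (∀ (g : ↥(HodgeCM.HermSpace3.adelicFin V)) (w : (datum413 hDel F V a₀ Φ i).omegaAt t),
                ψ ((datum413 hDel F V a₀ Φ i).rhoAt t g w) = rightRep F V g (ψ w)) →
              (∀ w, ψ w ∈ holCotForms (archFactorOf F V)) → ψ = 0) ∨
        (∀ ψ : (datum413 hDel F V a₀ Φ i).omegaAt t →ₗ[ℂ] ((adelicDatum F V).Adelic → (Fin 2 → ℂ)),
            (∀ (g : ↥(HodgeCM.HermSpace3.adelicFin V)) (w : (datum413 hDel F V a₀ Φ i).omegaAt t),
                ψ ((datum413 hDel F V a₀ Φ i).rhoAt t g w) = rightRep F V g (ψ w)) →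
              (∀ w, ψ w ∈ (holCotForms (archFactorOf F V)).map (conjFun F V)) → ψ = 0) :=
  stubS5_of_letters hE2' hDh hDa Summit.HodgeConjecture.HodgeConjecture.Cruxes.H413.CohFormsL2.continuous_apply_of_mem_cohForms

end Summit.HodgeConjecture.HodgeConjecture.Cruxes.H413.F0P3StubS5Fold

end
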